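import Literature.MathematicalPhysics.QuantumFieldTheory.FiniteTemperatureCentreIsingBound
import Literature.MathematicalPhysics.QuantumFieldTheory.ClockLayerHighTemperature
import HarnessLib

/-!
# Temperature-independent Polyakov confinement windows through the represented centre — the three
# routes unified (central involution ∕ central circle ∕ central odd cyclic group), and `SU(N)` for every `N`

Composition file (theorems only, no definitions, no named facts) over the three calibration files of the
barrier `Literature.Barriers.QuantumFields.FiniteTemperatureDeconfinement` produced by this seat:
`FiniteTemperatureCentreIsingBound.lean` (central involution represented by `−1`: Ising stack, window
`N·J_E < β_c(d)`), `U1FiniteTemperatureXYStack.lean` (central circle: XY stack, window `N·J_E < 2β_c(d)`),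
`ClockLayerHighTemperature.lean` (central `ℤ_n`, `n` odd: clock stack + high-temperature expansion,
window `2d(e^{2N J_E} − 1) < 1`). Borgs–Seiler (II.55): «Irrespective of `J_M` and temperature we are
sure to have confinement for `J_E < J_c`» — here for every compact gauge group whose represented centre
contains `U(1)` or an odd cyclic group, with explicit `L₀`-independent `J_c`, and for `SU(N)`, EVERY
`N ≥ 2`, in one statement.

## Results

* `abs_polyakovCorrelation_le_torusXY_pow_of_centralCircle`, `tendsto_zero_of_centralCircle_of_lt_two_mul_criticalBeta`,
  `two_mul_criticalBeta_le_of_centralCircle_of_hasPolyakovLongRangeOrder` — any compact `G`, continuous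
  unitary `ρ`, continuous `ι : U(1) → Z(G)` with `ρ(ι z) = z·1`: `|G_L^{G,ρ}| ≤ N²(⟨cos⟩^{XY}_{N J_E})^{L₀}`,
  confinement at every `L₀`, every `J_M ≥ 0` for `N·J_E < 2β_c(d)` (`d ≥ 2`).
* `abs_polyakovCorrelation_le_of_centralOdd`, `tendsto_zero_of_centralOdd`,
  `htRate_ge_one_of_centralOdd_of_hasPolyakovLongRangeOrder` — any compact `G` with `ι : ℤ_n → Z(G)`,
  `n` odd ≥ 3, `ρ(ι z) = z·1`: confinement at every `L₀`, `J_M ≥ 0` for `2d(e^{2N J_E} − 1) < 1`.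
* ★ `suN_confinement_window` — **for every `N ≥ 2` and `d ≥ 2` there is `J_c(N, d) > 0` (explicit:
  `β_c(d)/N` for even `N`, `log(1 + 1/(2d))/(2N)` for odd `N`) such that for all `0 ≤ J_E < J_c`, all
  `J_M ≥ 0` and EVERY temporal extent `L₀` every thermodynamic limit of the `SU(N)` Polyakov two-point
  function tends to `0`** — the restriction of the barrier's class (i) `PolyakovConfinementAtAllCouplings`
  to the strip `{J_E < J_c}` holds for every `SU(N)` (while class (i) itself is false in `d ≥ 3`, tree
  `not_polyakovConfinementAtAllCouplings_specialUnitary`-type results of the barrier Holds file).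
* ★ `suN_transition_window` (`d ≥ 3`, every `L₀`, every `N ≥ 2`): a strip of confinement
  `{0 ≤ J_E < J_c(N,d)} × {J_M ≥ 0}` below and Borgs–Seiler deconfinement `β ≥ β₀(L₀)` above, `J_c ≤ β₀`.
* `unitaryGroup_confinement_window` (`U(N)`, every `N`).

## Honest framing

Strong-coupling strips, lattice, finite volume with volume-uniform bounds; obtained only through the
centre; the constants are those of the three route files. Nothing at weak coupling or in the continuum;
the Yang–Mills mass gap (Clay) is NOT proved by any of this, and in the `ym` ladder only the
conditional finite-`𝕋⁴` rung `BalabanLadder.UV` is closed.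

## References

* C. Borgs, E. Seiler, Commun. Math. Phys. 91 (1983) 329–380: §II.3 (II.22)–(II.23) p. 337; §II.4
  (II.55)–(II.56) p. 343; §III.2 Thm III.7 p. 353; §IV pp. 358–359. [BorgsSeiler1983]
* H. Grosse, *Models in Statistical Physics and Quantum Field Theory* (1988), §4.2.4 (4.134). [Grosse1988]
-/

noncomputable section

open MeasureTheory Filter Finset
open scoped Topology
open Literature.Probability.LatticeModels Literature.MathematicalPhysics.QuantumLattice
open Literature.Barriers.QuantumFields Literature.Barriers.QuantumFields.FiniteTemperature

namespace Literature.MathematicalPhysics.QuantumFieldTheory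

section Central

variable {d L₀ L : ℕ} {G : Type*} [Group G] [TopologicalSpace G] [IsTopologicalGroup G]
  [CompactSpace G] [MeasurableSpace G] [BorelSpace G] [SecondCountableTopology G] {N : ℕ}
  (ρ : G →* Matrix (Fin N) (Fin N) ℂ)

/-- Every element of `U(1)` is a square. [folklore] -/
private theorem surjective_mul_self_circle₀ : Function.Surjective fun ψ : Circle => ψ * ψ := fun θ =>
  ⟨Circle.exp (Complex.arg (θ : ℂ) / 2), by
    show Circle.exp _ * Circle.exp _ = θ
    rw [← Circle.exp_add, add_halves, Circle.exp_arg]⟩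

/-! ### 1. A central circle: the XY route for every compact `G` -/

/-- **Central circle: the XY stack bound.** For a continuous `ι : U(1) → Z(G)` with `ρ(ι z) = z·1`:
`|G_L^{G,ρ}(x; J_E, J_M)| ≤ N² (⟨cos(θ_0 − θ_x)⟩^{XY}_{(ℤ/L)^d, N J_E})^{L₀}` (`J_E, J_M ≥ 0`).
[cite: Grosse1988, §4.2.4 eq. (4.134)] [cite: BorgsSeiler1983, §IV (pp. 358–359)] -/
theorem abs_polyakovCorrelation_le_torusXY_pow_of_centralCircle [NeZero L₀] [NeZero L] (ι : Circle →* G)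
    (hρ : Continuous ρ) (hρu : ∀ g, ρ g ∈ Matrix.unitaryGroup (Fin N) ℂ) (hιc : Continuous ι)
    (hι : ∀ z, ι z ∈ Subgroup.center G) (hρι : ∀ z, ρ (ι z) = ((z : ℂ)) • (1 : Matrix (Fin N) (Fin N) ℂ))
    {JE JM : ℝ} (hJE : 0 ≤ JE) (hJM : 0 ≤ JM) (x : TorusSite d L) :
    |polyakovCorrelation (L₀ := L₀) ρ JE JM x| ≤
      (N : ℝ) ^ 2 * ((torusXY d L).expectJ (fun _ => (N : ℝ) * JE) (cosDiff x 0)) ^ L₀ := by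
  have h := ThermalCentre.abs_polyakovCorrelation_le_abelianCentre (d := d) (L₀ := L₀) (L := L) ρ ι
    surjective_mul_self_circle₀ (ContinuousMonoidHom.id Circle) hρ hρu hιc hι (fun z => hρι z) hJE hJM x
  rw [charRep_id_circle] at h
  exact h.trans (mul_le_mul_of_nonneg_left
    (u1_polyakovCorrelation_le_torusXY_pow (by positivity) (by positivity) x) (by positivity))

/-- **Central circle: confinement at every temperature and every `J_M ≥ 0` for `N·J_E < 2β_c(d)`**
(`d ≥ 2`). [cite: BorgsSeiler1983, §II.4 (II.55)–(II.56) (p. 343); §IV (pp. 358–359)] -/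
theorem tendsto_zero_of_centralCircle_of_lt_two_mul_criticalBeta (hd : 2 ≤ d) (ι : Circle →* G)
    (hρ : Continuous ρ) (hρu : ∀ g, ρ g ∈ Matrix.unitaryGroup (Fin N) ℂ) (hιc : Continuous ι)
    (hι : ∀ z, ι z ∈ Subgroup.center G) (hρι : ∀ z, ρ (ι z) = ((z : ℂ)) • (1 : Matrix (Fin N) (Fin N) ℂ))
    (L₀ : ℕ) [NeZero L₀] {JE JM : ℝ} (hJE : 0 ≤ JE) (hJEc : (N : ℝ) * JE < 2 * criticalBeta d) (hJM : 0 ≤ JM)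
    {Ginf : (Fin d → ℤ) → ℝ} (hG : IsThermodynamicLimit (d := d) (L₀ := L₀) ρ JE JM Ginf) :
    Tendsto Ginf cofinite (𝓝 0) := by
  have hdom : ∀ (L : ℕ) [NeZero L] (x : Fin d → ZMod L),
      |polyakovCorrelation (L₀ := L₀) ρ JE JM x| ≤
        (N : ℝ) ^ 2 * polyakovCorrelation (L₀ := L₀) u1Rep ((N : ℝ) * JE) ((N : ℝ) * JM) x := by
    intro L _ x
    have h := ThermalCentre.abs_polyakovCorrelation_le_abelianCentre (d := d) (L₀ := L₀) (L := L) ρ ι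
      surjective_mul_self_circle₀ (ContinuousMonoidHom.id Circle) hρ hρu hιc hι (fun z => hρι z) hJE hJM x
    rwa [charRep_id_circle] at h
  obtain ⟨R, θ, hR, hθ0, hθ1, hdec⟩ :=
    u1_polyakovCorrelation_decay_of_lt_two_mul_criticalBeta hd (by positivity : 0 ≤ (N : ℝ) * JE) hJEc
  -- squeeze every thermodynamic limit
  obtain ⟨φ, hφ, hlim⟩ := hG
  have hbound : ∀ x : Fin d → ℤ, |Ginf x| ≤ (N : ℝ) ^ 2 * θ ^ (L₀ * (Site.supNorm x / R)) := by
    intro x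
    have hev : ∀ᶠ k : ℕ in atTop,
        |polyakovCorrelation (L₀ := L₀) (L := 2 * φ k + 2) ρ JE JM (fun i => ((x i : ℤ) : ZMod (2 * φ k + 2)))| ≤
          (N : ℝ) ^ 2 * θ ^ (L₀ * (Site.supNorm x / R)) := by
      have h1 : ∀ᶠ k : ℕ in atTop, 2 * R + 2 ≤ 2 * φ k + 2 ∧ 2 * Site.supNorm x ≤ 2 * φ k + 2 := by
        refine eventually_atTop.2 ⟨R + Site.supNorm x, fun k hk => ?_⟩
        have hk' : k ≤ φ k := hφ.id_le k
        constructor <;> omega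
      filter_upwards [h1] with k hk
      exact (hdom _ _).trans (mul_le_mul_of_nonneg_left (hdec L₀ _ (by positivity) _ hk.1 x hk.2).2 (by positivity))
    exact le_of_tendsto ((continuous_abs.tendsto _).comp (hlim x)) hev
  have hθL : θ ^ L₀ < 1 := pow_lt_one₀ hθ0 hθ1 (NeZero.ne L₀)
  have hq : Tendsto (fun x : Fin d → ℤ => Site.supNorm x / R) cofinite atTop := by
    refine tendsto_atTop.2 fun n => ?_
    have h := (tendsto_norm_cofinite_atTop (d := d)).eventually_ge_atTop (((n * R : ℕ) : ℝ))
    filter_upwards [h] with x hx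
    rw [Site.norm_eq_supNorm] at hx
    have hx' : n * R ≤ Site.supNorm x := by exact_mod_cast hx
    exact (Nat.le_div_iff_mul_le (by omega)).2 hx'
  have hmaj : Tendsto (fun x : Fin d → ℤ => (N : ℝ) ^ 2 * θ ^ (L₀ * (Site.supNorm x / R))) cofinite (𝓝 0) := by
    have h := ((tendsto_pow_atTop_nhds_zero_of_lt_one (pow_nonneg hθ0 L₀) hθL).comp hq).const_mul ((N : ℝ) ^ 2)
    rw [mul_zero] at h
    refine h.congr fun x => ?_
    simp only [Function.comp_apply, ← pow_mul]
  refine squeeze_zero_norm (fun x => ?_) hmaj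
  rw [Real.norm_eq_abs]
  exact hbound x

/-- **Central circle: Polyakov long-range order forces `N·J_E ≥ 2β_c(d)`** (`d ≥ 2`).
[cite: BorgsSeiler1983, §III.2 Thm III.7 (p. 353); §IV (pp. 358–359)] -/
theorem two_mul_criticalBeta_le_of_centralCircle_of_hasPolyakovLongRangeOrder (hd : 2 ≤ d) (ι : Circle →* G)
    (hρ : Continuous ρ) (hρu : ∀ g, ρ g ∈ Matrix.unitaryGroup (Fin N) ℂ) (hιc : Continuous ι)
    (hι : ∀ z, ι z ∈ Subgroup.center G) (hρι : ∀ z, ρ (ι z) = ((z : ℂ)) • (1 : Matrix (Fin N) (Fin N) ℂ))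
    (L₀ : ℕ) [NeZero L₀] {JE JM : ℝ} (hJE : 0 ≤ JE) (hJM : 0 ≤ JM) (h : HasPolyakovLongRangeOrder d L₀ ρ JE JM) :
    2 * criticalBeta d ≤ (N : ℝ) * JE := by
  by_contra hlt
  push Not at hlt
  obtain ⟨Ginf, hG⟩ := exists_isThermodynamicLimit (d := d) (L₀ := L₀) ρ hρ hρu JE JM
  exact h Ginf hG (tendsto_zero_of_centralCircle_of_lt_two_mul_criticalBeta ρ hd ι hρ hρu hιc hι hρι L₀ hJE hlt hJM hG)

/-! ### 2. A central odd cyclic group: the clock route for every compact `G` -/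

/-- **Central `ℤ_n`, `n` odd ≥ 3: the clock-layer high-temperature bound.** For `ι : ℤ_n → Z(G)` with
`ρ(ι z) = z·1`, `L ≥ 3`, `J_E, J_M ≥ 0`, `r = 2d(e^{2N J_E} − 1) < 1` and `2‖x‖_∞ ≤ L`:
`|G_L^{G,ρ}(x̄; J_E, J_M)| ≤ N² (r^{‖x‖_∞}/(1 − r))^{L₀}`. [cite: Grosse1988, §4.2.4 eq. (4.134)] [cite: BorgsSeiler1983, §II.4 (II.55) (p. 343); §IV (pp. 358–359)] -/
theorem abs_polyakovCorrelation_le_of_centralOdd [NeZero L₀] [NeZero L] {n : ℕ} (hn : Odd n) (hn3 : 3 ≤ n)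
    (ι : ↥(rootsOfUnityCircle n) →* G) (hρ : Continuous ρ) (hρu : ∀ g, ρ g ∈ Matrix.unitaryGroup (Fin N) ℂ)
    (hι : ∀ z, ι z ∈ Subgroup.center G)
    (hρι : ∀ z, ρ (ι z) = (((z : Circle) : ℂ)) • (1 : Matrix (Fin N) (Fin N) ℂ)) (hL : 3 ≤ L)
    {JE JM : ℝ} (hJE : 0 ≤ JE) (hr : htRate d ((N : ℝ) * JE) < 1) (hJM : 0 ≤ JM)
    (x : Literature.Probability.LatticeModels.Site d) (hx : 2 * Site.supNorm x ≤ L) :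
    |polyakovCorrelation (L₀ := L₀) ρ JE JM (Torus.proj L x)| ≤
      (N : ℝ) ^ 2 * (htRate d ((N : ℝ) * JE) ^ Site.supNorm x / (1 - htRate d ((N : ℝ) * JE))) ^ L₀ := by
  haveI : NeZero n := ⟨by omega⟩
  refine (ThermalCentre.abs_polyakovCorrelation_le_zn_of_neZero (d := d) (L₀ := L₀) (L := L) ρ ι hρ hρu hι hρι
    hJE hJM (Torus.proj L x)).trans (mul_le_mul_of_nonneg_left ?_ (by positivity))
  exact (zn_polyakovCorrelation_le_of_odd (L₀ := L₀) hn hn3 hL (by positivity) hr (by positivity) x hx).2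

/-- **Central `ℤ_n`, `n` odd ≥ 3: confinement at every temperature and every `J_M ≥ 0` for
`2d(e^{2N J_E} − 1) < 1`.** [cite: BorgsSeiler1983, §II.4 (II.55)–(II.56) (p. 343); §IV (pp. 358–359)] -/
theorem tendsto_zero_of_centralOdd {n : ℕ} (hn : Odd n) (hn3 : 3 ≤ n) (ι : ↥(rootsOfUnityCircle n) →* G)
    (hρ : Continuous ρ) (hρu : ∀ g, ρ g ∈ Matrix.unitaryGroup (Fin N) ℂ) (hι : ∀ z, ι z ∈ Subgroup.center G)
    (hρι : ∀ z, ρ (ι z) = (((z : Circle) : ℂ)) • (1 : Matrix (Fin N) (Fin N) ℂ))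
    (L₀ : ℕ) [NeZero L₀] {JE JM : ℝ} (hJE : 0 ≤ JE) (hr : htRate d ((N : ℝ) * JE) < 1) (hJM : 0 ≤ JM)
    {Ginf : (Fin d → ℤ) → ℝ} (hG : IsThermodynamicLimit (d := d) (L₀ := L₀) ρ JE JM Ginf) :
    Tendsto Ginf cofinite (𝓝 0) := by
  set a : ℝ := htRate d ((N : ℝ) * JE) with ha
  have ha0 : 0 ≤ a := htRate_nonneg d (by positivity)
  obtain ⟨φ, hφ, hlim⟩ := hG
  have hbound : ∀ x : Fin d → ℤ, |Ginf x| ≤ (N : ℝ) ^ 2 * (a ^ Site.supNorm x / (1 - a)) ^ L₀ := by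
    intro x
    have hev : ∀ᶠ k : ℕ in atTop,
        |polyakovCorrelation (L₀ := L₀) (L := 2 * φ k + 2) ρ JE JM (fun i => ((x i : ℤ) : ZMod (2 * φ k + 2)))| ≤
          (N : ℝ) ^ 2 * (a ^ Site.supNorm x / (1 - a)) ^ L₀ := by
      have h1 : ∀ᶠ k : ℕ in atTop, 3 ≤ 2 * φ k + 2 ∧ 2 * Site.supNorm x ≤ 2 * φ k + 2 := by
        refine eventually_atTop.2 ⟨1 + Site.supNorm x, fun k hk => ?_⟩
        have hk' : k ≤ φ k := hφ.id_le k
        constructor <;> omega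
      filter_upwards [h1] with k hk
      exact abs_polyakovCorrelation_le_of_centralOdd (L₀ := L₀) ρ hn hn3 ι hρ hρu hι hρι hk.1 hJE hr hJM x hk.2
    exact le_of_tendsto ((continuous_abs.tendsto _).comp (hlim x)) hev
  have hq : Tendsto (fun x : Fin d → ℤ => Site.supNorm x) cofinite atTop := by
    refine tendsto_atTop.2 fun m => ?_
    have h := (tendsto_norm_cofinite_atTop (d := d)).eventually_ge_atTop ((m : ℕ) : ℝ)
    filter_upwards [h] with x hx
    rw [Site.norm_eq_supNorm] at hx
    exact_mod_cast hx
  have hmaj : Tendsto (fun x : Fin d → ℤ => (N : ℝ) ^ 2 * (a ^ Site.supNorm x / (1 - a)) ^ L₀) cofinite (𝓝 0) := by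
    have h := (((tendsto_pow_atTop_nhds_zero_of_lt_one ha0 hr).comp hq).div_const (1 - a)).pow L₀
      |>.const_mul ((N : ℝ) ^ 2)
    rw [zero_div, zero_pow (NeZero.ne L₀), mul_zero] at h
    exact h
  refine squeeze_zero_norm (fun x => ?_) hmaj
  rw [Real.norm_eq_abs]
  exact hbound x

/-- **Central `ℤ_n`, `n` odd ≥ 3: Polyakov long-range order forces `2d(e^{2N J_E} − 1) ≥ 1`.**
[cite: BorgsSeiler1983, §III.2 Thm III.7 (p. 353); §II.4 (II.55) (p. 343)] -/
theorem htRate_ge_one_of_centralOdd_of_hasPolyakovLongRangeOrder {n : ℕ} (hn : Odd n) (hn3 : 3 ≤ n)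
    (ι : ↥(rootsOfUnityCircle n) →* G) (hρ : Continuous ρ) (hρu : ∀ g, ρ g ∈ Matrix.unitaryGroup (Fin N) ℂ)
    (hι : ∀ z, ι z ∈ Subgroup.center G)
    (hρι : ∀ z, ρ (ι z) = (((z : Circle) : ℂ)) • (1 : Matrix (Fin N) (Fin N) ℂ)) (L₀ : ℕ) [NeZero L₀]
    {JE JM : ℝ} (hJE : 0 ≤ JE) (hJM : 0 ≤ JM) (h : HasPolyakovLongRangeOrder d L₀ ρ JE JM) :
    1 ≤ htRate d ((N : ℝ) * JE) := by
  by_contra hlt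
  push Not at hlt
  obtain ⟨Ginf, hG⟩ := exists_isThermodynamicLimit (d := d) (L₀ := L₀) ρ hρ hρu JE JM
  exact h Ginf hG (tendsto_zero_of_centralOdd ρ hn hn3 ι hρ hρu hι hρι L₀ hJE hlt hJM hG)

end Central

/-! ### 3. `SU(N)` for every `N ≥ 2`, and `U(N)` -/

section SUN

variable {d : ℕ}

/-- `J_E < log(1 + 1/(2d))/(2N)` puts `N J_E` in the high-temperature window `2d(e^{2N J_E} − 1) < 1`. [cite: FriedliVelenik2017, §3.7.3 eq. (3.49) (p. 130)] -/
private theorem htRate_lt_one_of_lt (hd : 1 ≤ d) {N : ℕ} (hN : 1 ≤ N) {JE : ℝ}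
    (hJE : JE < Real.log (1 + 1 / (2 * d)) / (2 * N)) : htRate d ((N : ℝ) * JE) < 1 := by
  have hd' : (0 : ℝ) < 2 * d := by positivity
  have hN' : (0 : ℝ) < 2 * N := by positivity
  have h1 : 2 * ((N : ℝ) * JE) < Real.log (1 + 1 / (2 * d)) := by
    have := (lt_div_iff₀ hN').1 hJE
    linarith
  have h2 : Real.exp (2 * ((N : ℝ) * JE)) < 1 + 1 / (2 * d) := by
    calc Real.exp (2 * ((N : ℝ) * JE)) < Real.exp (Real.log (1 + 1 / (2 * d))) := Real.exp_lt_exp.2 h1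
      _ = 1 + 1 / (2 * d) := Real.exp_log (by positivity)
  unfold htRate
  calc 2 * (d : ℝ) * (Real.exp (2 * ((N : ℝ) * JE)) - 1) < 2 * (d : ℝ) * (1 / (2 * d)) := by
        exact mul_lt_mul_of_pos_left (by linarith) hd'
    _ = 1 := by field_simp

/-- ★ **`SU(N)`, EVERY `N ≥ 2`: a temperature-independent confinement strip.** For `d ≥ 2` there is
`J_c = J_c(N, d) > 0` — `β_c(d)/N` for even `N` (Ising route), `log(1 + 1/(2d))/(2N)` for odd `N` (clock
route) — such that for all `0 ≤ J_E < J_c`, all `J_M ≥ 0` and EVERY temporal extent `L₀`, every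
thermodynamic limit of the `SU(N)` Polyakov two-point function tends to `0` (Polyakov confinement).
[cite: BorgsSeiler1983, §II.4 (II.55)–(II.56) (p. 343); §IV (pp. 358–359)] -/
theorem suN_confinement_window (hd : 2 ≤ d) {N : ℕ} (hN : 2 ≤ N) :
    ∃ Jc : ℝ, 0 < Jc ∧ ∀ (L₀ : ℕ) [NeZero L₀] (JE JM : ℝ), 0 ≤ JE → JE < Jc → 0 ≤ JM →
      ∀ Ginf : (Fin d → ℤ) → ℝ, IsThermodynamicLimit (d := d) (L₀ := L₀) (fundamentalRep (Fin N)) JE JM Ginf →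
        Tendsto Ginf cofinite (𝓝 0) := by
  rcases Nat.even_or_odd N with hev | hodd
  · refine ⟨criticalBeta d / N, div_pos (criticalBeta_pos_holds (d := d) hd) (by positivity), ?_⟩
    intro L₀ _ JE JM hJE hJEc hJM Ginf hG
    have hN0 : (0 : ℝ) < N := by positivity
    exact suN_tendsto_zero_of_even_of_lt_criticalBeta hd (even_iff_two_dvd.1 hev) L₀ hJE
      (by rwa [lt_div_iff₀ hN0, mul_comm] at hJEc) hJM hG
  · have hlog : 0 < Real.log (1 + 1 / (2 * d)) := by
      have : (0 : ℝ) < 1 / (2 * d) := by positivity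
      exact Real.log_pos (by linarith)
    refine ⟨Real.log (1 + 1 / (2 * d)) / (2 * N), div_pos hlog (by positivity), ?_⟩
    intro L₀ _ JE JM hJE hJEc hJM Ginf hG
    have hN3 : 3 ≤ N := by obtain ⟨k, hk⟩ := hodd; omega
    exact suN_tendsto_zero_of_odd_centre (n := N) hodd hN3 (dvd_refl N) L₀ hJE
      (htRate_lt_one_of_lt (by omega) (by omega) hJEc) hJM hG

/-- ★ **The two-sided window for every `SU(N)`, `N ≥ 2`, `d ≥ 3`, every `L₀`**: there are
`0 < J_c ≤ β₀` with NO Polyakov long-range order on `{0 ≤ J_E < J_c} × {J_M ≥ 0}` (this seat) and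
long-range order at `(β, β)` for all `β ≥ β₀` (Borgs–Seiler Thm III.7, tree `isotropic_specialUnitary_holds`).
[cite: BorgsSeiler1983, §II.4 (II.55) (p. 343); §III.2 Thm III.7 (p. 353)] -/
theorem suN_transition_window (hd : 3 ≤ d) {N : ℕ} (hN : 2 ≤ N) (L₀ : ℕ) [NeZero L₀] :
    ∃ Jc β₀ : ℝ, 0 < Jc ∧ Jc ≤ β₀ ∧
      (∀ JE JM : ℝ, 0 ≤ JE → JE < Jc → 0 ≤ JM →
        ¬ HasPolyakovLongRangeOrder d L₀ (fundamentalRep (Fin N)) JE JM) ∧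
      (∀ β : ℝ, β₀ ≤ β → HasPolyakovLongRangeOrder d L₀ (fundamentalRep (Fin N)) β β) := by
  obtain ⟨Jc, hJc, hconf⟩ := suN_confinement_window (d := d) (by omega) hN
  obtain ⟨β₀, hβ₀, hLRO⟩ := isotropic_specialUnitary_holds (N := N) hN hd L₀
  have hno : ∀ JE JM : ℝ, 0 ≤ JE → JE < Jc → 0 ≤ JM →
      ¬ HasPolyakovLongRangeOrder d L₀ (fundamentalRep (Fin N)) JE JM := by
    intro JE JM hJE hJEc hJM h
    obtain ⟨Ginf, hG⟩ := exists_isThermodynamicLimit (d := d) (L₀ := L₀) (fundamentalRep (Fin N))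
      (continuous_fundamentalRep (Fin N)) fundamentalRep_mem_unitaryGroup JE JM
    exact h Ginf hG (hconf L₀ JE JM hJE hJEc hJM Ginf hG)
  refine ⟨Jc, β₀, hJc, ?_, hno, hLRO⟩
  by_contra hlt
  push Not at hlt
  exact hno β₀ β₀ hβ₀.le hlt hβ₀.le (hLRO β₀ le_rfl)

/-- **`U(N)`, every `N`: a temperature-independent confinement strip** `{0 ≤ J_E < 2β_c(d)/max(N,1)}`
(`d ≥ 2`). [cite: BorgsSeiler1983, §II.4 (II.55)–(II.56) (p. 343); §IV (pp. 358–359)] -/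
theorem unitaryGroup_confinement_window (hd : 2 ≤ d) (N : ℕ) :
    ∃ Jc : ℝ, 0 < Jc ∧ ∀ (L₀ : ℕ) [NeZero L₀] (JE JM : ℝ), 0 ≤ JE → JE < Jc → 0 ≤ JM →
      ∀ Ginf : (Fin d → ℤ) → ℝ,
        IsThermodynamicLimit (d := d) (L₀ := L₀) (unitaryFundamentalRep (Fin N) ℂ) JE JM Ginf →
          Tendsto Ginf cofinite (𝓝 0) := by
  have hβ := criticalBeta_pos_holds (d := d) hd
  refine ⟨2 * criticalBeta d / max (N : ℝ) 1, div_pos (by positivity) (by positivity), ?_⟩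
  intro L₀ _ JE JM hJE hJEc hJM Ginf hG
  refine unitaryGroup_tendsto_zero_of_lt_two_mul_criticalBeta hd L₀ hJE ?_ hJM hG
  have hmax : (0 : ℝ) < max (N : ℝ) 1 := by positivity
  rw [lt_div_iff₀ hmax] at hJEc
  calc (N : ℝ) * JE ≤ max (N : ℝ) 1 * JE := mul_le_mul_of_nonneg_right (le_max_left _ _) hJE
    _ = JE * max (N : ℝ) 1 := mul_comm _ _
    _ < 2 * criticalBeta d := hJEc

end SUN

end Literature.MathematicalPhysics.QuantumFieldTheory

end
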